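import Mathlib
import HarnessLib
import Summits.ResolutionOfSingularities.ResolutionOfSingularities.Theorems.WildQuotientsWildQuotientResolutionS1aExtendRees
import Summits.ResolutionOfSingularities.ResolutionOfSingularities.Theorems.WildQuotientsWildQuotientResolutionS1aTopComponents

/-!
# S1a — EXTENSION BY THE UNIT FILTRATION, AUX SIDE: a local AUX centre with closed support extends to a global one

[OURS · L1 W4.5c · lead-1 g8; the A-side twin of `…S1aExtendRees` ((A2-glue)/(K2) «same lemma», plan-1 STRATEGY-DESIGN v3.5 §4 (2))] — NOT statements
of the manuscript; counted 0; AI-level work, weaker than expert review. Crux stmt-ResolutionOfSingularities-17941, line `s1a-logminvertex` v6.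

* `isCentreChart_image` — a centre chart upstairs is a centre chart of the extension downstairs (as `ExtendRees.isPrincipalCentreChart_image`);
* ★ `isAdmissibleCentre_pushforwardRees`, ★★ `isAuxCentre_pushforwardRees` — an ADMISSIBLE / AUX centre for the restricted action on a `G`-stable open
  `U` (aux relative to `U.ι ⁻¹ good`) whose support has CLOSED image in `V` extends to an admissible / AUX centre (relative to `good`) on `V`;
* ★★ `GameFrame.GModel.auxTopAt_of_local` — `AuxTopAt M` from: `jInf M = k`, a `G`-stable open `U`, an AUX centre `𝒦` on `↑U` (relative to the good
  points) with closed support image CONTAINING `topNonKillable M k`, and killability over the support along the moves of the extension.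
So the A-side research statement may be produced LOCALLY around the top components (recipe table v2), exactly like the K side.
-/

set_option linter.dupNamespace false

noncomputable section

universe u

open CategoryTheory Limits AlgebraicGeometry TopologicalSpace Topology
open Literature.AlgebraicGeometry.Resolution Literature.AlgebraicGeometry.RelativeSpec
open Summit.ResolutionOfSingularities.ResolutionOfSingularities.Theorems.WildQuotientResolution.S1
open Summit.ResolutionOfSingularities.ResolutionOfSingularities.Theorems.WildQuotientResolution.S1.NodeAtlas
open Summit.ResolutionOfSingularities.ResolutionOfSingularities.Theorems.WildQuotientResolution.S1.BlowupCharts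
open Summit.ResolutionOfSingularities.ResolutionOfSingularities.Theorems.WildQuotientResolution.S1.GoodCharts
open Summit.ResolutionOfSingularities.ResolutionOfSingularities.Theorems.WildQuotientResolution.S1.NodeChartAway
open Summit.ResolutionOfSingularities.ResolutionOfSingularities.Theorems.WildQuotientResolution.S1.KillableTransport
open Summit.ResolutionOfSingularities.ResolutionOfSingularities.Theorems.WildQuotientResolution.S1.KillFamily
open Summit.ResolutionOfSingularities.ResolutionOfSingularities.Theorems.WildQuotientResolution.S1.ExtendRees

namespace Summit.ResolutionOfSingularities.ResolutionOfSingularities.Theorems.WildQuotientResolution.S1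

namespace ExtendAux

/-! ## A centre chart upstairs is one downstairs -/

section Image

variable {V' V Y : Scheme.{u}} {q : V ⟶ Y} {r' : V' ⟶ Y} {G : Type u} [Group G] (ρ : ActionOver q G) (ρ' : ActionOver r' G)
  (j : V' ⟶ V) [IsOpenImmersion j] [QuasiCompact j] (hr' : r' = j ≫ q) (hcomm : ∀ g : G, (ρ'.aut g).hom ≫ j = j ≫ (ρ.aut g).hom)
  {p : ℕ} (g₀ : G)

include hr' hcomm in
/-- **A CENTRE CHART `U₀` OF `(V', ρ', 𝒦)` IS A CENTRE CHART `j '' U₀` OF `(V, ρ, pushforwardRees 𝒦 j)`.** [OURS · L1 W4.5c] -/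
theorem isCentreChart_image (𝒦 : ReesFiltration V') (d : ℕ) (U₀ : ρ'.StableAffineOpens) (hc : IsCentreChart p ρ' g₀ 𝒦 d U₀) :
    ∃ O : ρ.StableAffineOpens, O.1 = j ''ᵁ U₀.1 ∧ IsCentreChart p ρ g₀ (pushforwardRees 𝒦 j) d O := by
  obtain ⟨hO, m, r, B, _, 𝒜, _, σ, e, htame, hσ, c, f, δ, w, hc, hf, hw, hK1, hK1', hσJ, h𝒦, hver⟩ := hc
  have hstab : ∀ g : G, (ρ.aut g).hom ⁻¹ᵁ (j ''ᵁ U₀.1) = j ''ᵁ U₀.1 := image_stable ρ ρ' j hcomm U₀.1 U₀.2.1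
  have hO₁ : IsAffineOpen (j ''ᵁ U₀.1) := hO.image_of_isOpenImmersion j
  haveI : IsAffineHom ((j ''ᵁ U₀.1).ι ≫ q) := by
    rw [← Scheme.Hom.isoImage_inv_ι j U₀.1, Category.assoc, Category.assoc, ← hr']
    haveI := U₀.2.2
    infer_instance
  let O : ρ.StableAffineOpens := ⟨j ''ᵁ U₀.1, hstab, inferInstance⟩
  obtain ⟨P, hP⟩ : ∃ P : Γ(V, j ''ᵁ U₀.1) ≃+* Γ(V', U₀.1), ∀ s, P s = (j.appIso U₀.1).hom s :=
    ⟨(j.appIso U₀.1).commRingCatIsoToRingEquiv, fun _ => rfl⟩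
  have hPle : ∀ s, P s = j.appLE (j ''ᵁ U₀.1) U₀.1 (j.preimage_image_eq U₀.1).ge s := fun s => by
    rw [hP, Scheme.Hom.appIso_hom']
  refine ⟨O, rfl, hO₁, m, r, B, inferInstance, 𝒜, inferInstance, σ, P.trans e, htame, fun t => ?_, c, f, δ, w, hc, hf, hw, hK1, hK1', hσJ,
    fun n => ?_, hver⟩
  · have h1 : P ((ρ.aut g₀⁻¹).hom.appLE (j ''ᵁ U₀.1) (j ''ᵁ U₀.1) (hstab g₀⁻¹).ge t) =
        (ρ'.aut g₀⁻¹).hom.appLE U₀.1 U₀.1 (U₀.2.1 g₀⁻¹).ge (P t) := by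
      rw [hPle, hPle]
      exact (appLE_comm_of_le ρ ρ' hcomm (j ''ᵁ U₀.1) hstab U₀.1 U₀.2.1 (j.preimage_image_eq U₀.1).ge g₀⁻¹ t).symm
    change (((P.trans e) ((ρ.aut g₀⁻¹).hom.appLE O.1 O.1 (O.2.1 g₀⁻¹).ge t) : ↥(𝒜 0)) : B) = σ (((P.trans e) t : ↥(𝒜 0)) : B)
    rw [RingEquiv.trans_apply, RingEquiv.trans_apply, h1]
    exact hσ (P t)
  · have H : IsAffineOpen (j ⁻¹ᵁ j ''ᵁ U₀.1) := by rw [j.preimage_image_eq]; exact hO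
    rw [ReesFiltration.filtration_ideal, pushforwardRees_ideal, Scheme.IdealSheafData.ideal_map _ j ⟨j ''ᵁ U₀.1, hO₁⟩ H]
    ext s
    rw [Ideal.mem_comap, Ideal.mem_comap]
    have h3 : ((P.trans e : Γ(V, j ''ᵁ U₀.1) ≃+* ↥(𝒜 0)) : Γ(V, j ''ᵁ U₀.1) →+* ↥(𝒜 0)) s ∈ (CoarseChart.traceFiltration 𝒜 f w).ideal n ↔
        P s ∈ (𝒦.filtration ⟨U₀.1, hO⟩).ideal n := by
      rw [h𝒦 n, Ideal.mem_comap]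
      rfl
    rw [h3, ReesFiltration.filtration_ideal, hP]
    have h4 : (j.appIso U₀.1).hom s = (V'.presheaf.map (eqToHom (j.preimage_image_eq U₀.1).symm).op) ((j.app (j ''ᵁ U₀.1)) s) := by
      rw [Scheme.Hom.appIso_hom]
      rfl
    rw [h4]
    exact (map_eqToHom_mem_ideal_iff (𝒦.ideal n) (j.preimage_image_eq U₀.1).symm hO H _).symm

end Image

/-! ## The extension theorems, AUX side -/

section Extend

variable {V Y : Scheme.{u}} {q : V ⟶ Y} {G : Type u} [Group G] (ρ : ActionOver q G) {p : ℕ} (g₀ : G)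

/-- ★ **An ADMISSIBLE centre on a `G`-stable open with closed support extends to an admissible centre.** [OURS · L1 W4.5c] -/
theorem isAdmissibleCentre_pushforwardRees [Finite G] [IsLocallyNoetherian V] (hnode : NodeAtlas p ρ g₀) (U : V.Opens)
    (hU : ∀ g : G, (ρ.aut g).hom ⁻¹ᵁ U = U) (𝒦 : ReesFiltration (U : Scheme.{u})) {d : ℕ}
    (hadm : IsAdmissibleCentre p (ρ.restrict U hU) g₀ 𝒦 d)
    (hC : IsClosed (U.ι.base '' (((𝒦.ideal d).support : Set (U : Scheme.{u}))))) :
    IsAdmissibleCentre p ρ g₀ (pushforwardRees 𝒦 U.ι) d := by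
  have hcomm : ∀ g : G, ((ρ.restrict U hU).aut g).hom ≫ U.ι = U.ι ≫ (ρ.aut g).hom := fun g => by
    rw [ActionOver.restrict_aut_hom, ActionOver.restrictHom_ι]
  have hGst : ∀ (g : G) (n : ℕ), ((pushforwardRees 𝒦 U.ι).ideal n).comap (ρ.aut g).hom = (pushforwardRees 𝒦 U.ι).ideal n :=
    comap_aut_pushforwardRees ρ (ρ.restrict U hU) U.ι hcomm 𝒦 hadm.2.1
  have hsupp : (((pushforwardRees 𝒦 U.ι).ideal d).support : Set V) = U.ι.base '' ((𝒦.ideal d).support : Set (U : Scheme.{u})) := by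
    rw [support_pushforwardRees, hC.closure_eq]
  refine ⟨hadm.1, hGst, fun v => ?_⟩
  by_cases hv : v ∈ (((pushforwardRees 𝒦 U.ι).ideal d).support : Set V)
  · rw [hsupp] at hv
    obtain ⟨u, hus, rfl⟩ := hv
    obtain ⟨O₀, huO₀, hO₀ | hO₀⟩ := hadm.2.2 u
    swap
    · exact absurd hus (Set.disjoint_left.mp
        (disjoint_support_of_ideal_eq_top hO₀.1.1 (by rw [← ReesFiltration.filtration_ideal]; exact hO₀.2 d)) huO₀)
    obtain ⟨O, hOeq, hO⟩ := isCentreChart_image ρ (ρ.restrict U hU) U.ι rfl hcomm g₀ 𝒦 d O₀ hO₀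
    refine ⟨O, ?_, Or.inl hO⟩
    rw [hOeq]
    exact ⟨u, huO₀, rfl⟩
  · obtain ⟨O, hvO, hn⟩ := hnode v
    obtain ⟨O'', hvO'', -, hO''W, hn''⟩ := exists_isNodeChart_le hn hvO ((pushforwardRees 𝒦 U.ι).ideal d).support.compl
      (preimage_support_compl ρ (fun g => hGst g d)) hv
    refine ⟨O'', hvO'', Or.inr ⟨hn'', fun n => filtration_eq_top_of_disjoint _ hadm.1 ⟨O''.1, hn''.1⟩ ?_ n⟩⟩
    rw [Set.disjoint_left]
    intro x hx hx'
    exact hO''W hx hx'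

/-- ★★ **A local AUX centre with closed support extends to a global AUX centre**: if `𝒦` on `↑U` is admissible and PRINCIPAL-OR-IDLE at the points of
`U` over `good`, and its support has closed image, then `pushforwardRees 𝒦 U.ι` is an AUX centre on `V` relative to `good`. [OURS · L1 W4.5c] -/
theorem isAuxCentre_pushforwardRees [Finite G] [IsLocallyNoetherian V] (hnode : NodeAtlas p ρ g₀) (U : V.Opens)
    (hU : ∀ g : G, (ρ.aut g).hom ⁻¹ᵁ U = U) (𝒦 : ReesFiltration (U : Scheme.{u})) {d : ℕ} (good : Set V)
    (haux : IsAuxCentre p (ρ.restrict U hU) g₀ 𝒦 d (U.ι.base ⁻¹' good))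
    (hC : IsClosed (U.ι.base '' (((𝒦.ideal d).support : Set (U : Scheme.{u}))))) :
    IsAuxCentre p ρ g₀ (pushforwardRees 𝒦 U.ι) d good := by
  have hcomm : ∀ g : G, ((ρ.restrict U hU).aut g).hom ≫ U.ι = U.ι ≫ (ρ.aut g).hom := fun g => by
    rw [ActionOver.restrict_aut_hom, ActionOver.restrictHom_ι]
  have hadm := isAdmissibleCentre_pushforwardRees ρ g₀ hnode U hU 𝒦 haux.1 hC
  have hsupp : (((pushforwardRees 𝒦 U.ι).ideal d).support : Set V) = U.ι.base '' ((𝒦.ideal d).support : Set (U : Scheme.{u})) := by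
    rw [support_pushforwardRees, hC.closure_eq]
  refine ⟨hadm, fun v hv => ?_⟩
  by_cases hvs : v ∈ (((pushforwardRees 𝒦 U.ι).ideal d).support : Set V)
  · rw [hsupp] at hvs
    obtain ⟨u, hus, rfl⟩ := hvs
    obtain ⟨O₀, huO₀, hO₀ | hO₀⟩ := haux.2 u hv
    swap
    · exact absurd hus (Set.disjoint_left.mp
        (disjoint_support_of_ideal_eq_top hO₀.1.1 (by rw [← ReesFiltration.filtration_ideal]; exact hO₀.2 d)) huO₀)
    obtain ⟨O, hOeq, hO⟩ := isPrincipalCentreChart_image ρ (ρ.restrict U hU) U.ι rfl hcomm g₀ 𝒦 d O₀ hO₀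
    refine ⟨O, ?_, Or.inl hO⟩
    rw [hOeq]
    exact ⟨u, huO₀, rfl⟩
  · obtain ⟨O, hvO, hn⟩ := hnode v
    obtain ⟨O'', hvO'', -, hO''W, hn''⟩ := exists_isNodeChart_le hn hvO ((pushforwardRees 𝒦 U.ι).ideal d).support.compl
      (preimage_support_compl ρ (fun g => hadm.2.1 g d)) hvs
    refine ⟨O'', hvO'', Or.inr ⟨hn'', fun n => filtration_eq_top_of_disjoint _ hadm.1 ⟨O''.1, hn''.1⟩ ?_ n⟩⟩
    rw [Set.disjoint_left]
    intro x hx hx'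
    exact hO''W hx hx'

end Extend

end ExtendAux

/-! ## Model form: `AuxTopAt` from local data around the top components -/

namespace GameFrame.GModel

open ExtendRees ExtendAux TopComponents

variable {p : ℕ} {X' X₁ : Scheme.{0}} {q : X' ⟶ X₁} {G : Type} [Group G] {ρ : G →* Aut X'} {g₀ : G}

/-- ★★ **`AuxTopAt M` FROM LOCAL DATA**: `jInf M = k`; a `G`-stable open `U`; an AUX centre `𝒦` (degree `d`) for the restricted action on `↑U`,
principal-or-idle at the good points, whose support has CLOSED image containing the top components `topNonKillable M k`; and killability over the
support along every move of the EXTENSION `pushforwardRees 𝒦 U.ι`. [OURS · L1 W4.5c] -/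
theorem auxTopAt_of_local [Finite G] (M : GModel p q G ρ g₀) [CompactSpace M.V] {k : ℕ} (hk : M.jInf = k) (U : M.V.Opens)
    (hU : ∀ g : G, (M.act.aut g).hom ⁻¹ᵁ U = U) (𝒦 : ReesFiltration (U : Scheme.{0})) {d : ℕ}
    (haux : IsAuxCentre p (M.act.restrict U hU) g₀ 𝒦 d (U.ι.base ⁻¹' (M.badLocus)ᶜ))
    (hC : IsClosed (U.ι.base '' (((𝒦.ideal d).support : Set (U : Scheme.{0})))))
    (hZ : M.topNonKillable k ⊆ U.ι.base '' (((𝒦.ideal d).support : Set (U : Scheme.{0}))))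
    (hkill : ∀ (M' : GModel p q G ρ g₀) (π' : M'.V ⟶ M.V), IsBlowup π' ((pushforwardRees 𝒦 U.ι).ideal d) → M'.π = π' ≫ M.π →
        M'.r = π' ≫ M.r → (∀ g : G, (M'.act.aut g).hom ≫ π' = π' ≫ (M.act.aut g).hom) →
        ∀ v' ∈ M'.badLocus, π'.base v' ∈ (((pushforwardRees 𝒦 U.ι).ideal d).support : Set M.V) → M'.KillableAt v') :
    M.AuxTopAt := by
  haveI : IsLocallyNoetherian M.V := M.isLocallyNoetherian
  have hsupp : (((pushforwardRees 𝒦 U.ι).ideal d).support : Set M.V) = U.ι.base '' ((𝒦.ideal d).support : Set (U : Scheme.{0})) := by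
    rw [support_pushforwardRees, hC.closure_eq]
  refine M.auxTopAt_of_topNonKillable hk (isAuxCentre_pushforwardRees M.act g₀ M.atlas U hU 𝒦 (M.badLocus)ᶜ haux hC) ?_ hkill
  rw [hsupp]
  exact hZ

end GameFrame.GModel

end Summit.ResolutionOfSingularities.ResolutionOfSingularities.Theorems.WildQuotientResolution.S1

end
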